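import Mathlib
import HarnessLib
import Summits.Ventures.LatticeQCDFlow.Exactness.CPNOverrelaxation
import Summits.Ventures.LatticeQCDFlow.Exactness.SphereFrameLift

/-!
# Caps of the sphere: the halfway point of two points, cap inclusions by the spherical triangle inequality, and the uniform law of a cap (rotation invariant, positive)

HONEST FRAMING: exact (Metropolis-corrected) sampling algorithms for lattice gauge theory;
figures of merit are autocorrelation/cost numbers at stated couplings and volumes; no
continuum-physics claim.

Venture `LatticeQCDFlow` (cell pub-lqcd), topic `Exactness`, FANOUT row 9 (eng-latcore; toward
multi-step HMC / bounded-kick samplers on the `cpn_2d` sphere family, whose one-step minorisation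
covers only a SMALL CAP around the current point: design in HOME/eng-latcore/HANDOFF.md GEN-19).  NEW WORK
of the cell over Mathlib (`InnerProductGeometry.angle`, the spherical triangle inequality
`angle_le_angle_add_angle`, `Real.cos_sq_half`, `Real.strictAntiOn_cos`) and the tree (row 7/9/16:
`uniformSphere`, `uniformSphere_map_linearIsometryEquiv`, `rotSO`, `actSO`, `exists_actSO_eq`); nothing is
cited as a fact; no number.

THE POINT (geometric half of the CAP-CHAINING lemma "small uniform moves on a sphere cover it in
finitely many steps" — the sphere analogue of `ConnectedGroupKickCovering.lean`; the kernel induction is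
the sequel):

* §1 `sphereCap x r = {y : angle x y < r}` (`isOpen_sphereCap`, `measurableSet_sphereCap`,
  `mem_sphereCap_self`, `sphereCap_mono`), **`sphereCap_subset_inter`** — `angle x w + ρ ≤ r₁`,
  `angle z w + ρ ≤ r₂` ⇒ `cap(w, ρ) ⊆ cap(x, r₁) ∩ cap(z, r₂)` (triangle inequality).
* §2 **`angle_self_add`** — for unit `x, z` with `x + z ≠ 0`: `angle x (x + z) = angle x z / 2` (the
  halfway point; half-angle formula), `angle_add_self'` (symmetric); **`exists_halfway`** (`dim ≥ 2`):
  for all `x, z ∈ S` there is `w ∈ S` with `angle x w ≤ angle x z / 2` and `angle z w ≤ angle x z / 2` (the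
  normalised sum, or — for antipodes — any unit vector orthogonal to `x`).
* §3 **`uniformSphere_sphereCap_eq`** — `σ(cap(x, r)) = σ(cap(y, r))` (transitivity of rotations +
  invariance of `σ`), **`uniformSphere_sphereCap_pos`** — `0 < σ(cap(x, r))` for `r > 0` (a finite
  subcover of the compact sphere by open caps of equal measure and total mass one).

NOT CLAIMED: the chaining / kernel-power statement itself (sequel), explicit values of `σ(cap)`,
anything about products of spheres (componentwise, sequel).
-/

noncomputable section

namespace Summit.Ventures.LatticeQCDFlow.Exactness

open MeasureTheory Measure Metric Set Real InnerProductGeometry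
open scoped ENNReal InnerProductSpace

variable {m : Type*} [Fintype m]

/-! ## §1 Caps -/

/-- **The open cap** of angular radius `r` around `x`: `{y ∈ S : angle x y < r}`. -/
def sphereCap (x : sphere (0 : EuclideanSpace ℝ m) 1) (r : ℝ) : Set (sphere (0 : EuclideanSpace ℝ m) 1) :=
  {y | angle (x : EuclideanSpace ℝ m) (y : EuclideanSpace ℝ m) < r}

/-- Membership. -/
theorem mem_sphereCap {x y : sphere (0 : EuclideanSpace ℝ m) 1} {r : ℝ} :
    y ∈ sphereCap x r ↔ angle (x : EuclideanSpace ℝ m) (y : EuclideanSpace ℝ m) < r := Iff.rfl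

/-- The angle to a fixed point is continuous on the sphere. -/
theorem continuous_angle_sphere (x : sphere (0 : EuclideanSpace ℝ m) 1) :
    Continuous fun y : sphere (0 : EuclideanSpace ℝ m) 1 => angle (x : EuclideanSpace ℝ m) (y : EuclideanSpace ℝ m) := by
  unfold InnerProductGeometry.angle
  refine Real.continuous_arccos.comp ((continuous_const.inner continuous_subtype_val).div
    (continuous_const.mul (continuous_norm.comp continuous_subtype_val)) fun y => ?_)
  rw [norm_eq_of_mem_sphere x, norm_eq_of_mem_sphere y]
  norm_num

/-- Caps are open. -/
theorem isOpen_sphereCap (x : sphere (0 : EuclideanSpace ℝ m) 1) (r : ℝ) : IsOpen (sphereCap x r) :=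
  isOpen_lt (continuous_angle_sphere x) continuous_const

/-- Caps are measurable. -/
theorem measurableSet_sphereCap (x : sphere (0 : EuclideanSpace ℝ m) 1) (r : ℝ) : MeasurableSet (sphereCap x r) :=
  (isOpen_sphereCap x r).measurableSet

/-- The centre is in its cap (`r > 0`). -/
theorem mem_sphereCap_self (x : sphere (0 : EuclideanSpace ℝ m) 1) {r : ℝ} (hr : 0 < r) : x ∈ sphereCap x r := by
  rw [mem_sphereCap, angle_self (ne_zero_of_mem_unit_sphere x)]
  exact hr

/-- Caps grow with the radius. -/
theorem sphereCap_mono (x : sphere (0 : EuclideanSpace ℝ m) 1) {r r' : ℝ} (h : r ≤ r') : sphereCap x r ⊆ sphereCap x r' :=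
  fun _ hy => lt_of_lt_of_le hy h

/-- Caps of radius `> π` are everything. -/
theorem sphereCap_eq_univ (x : sphere (0 : EuclideanSpace ℝ m) 1) {r : ℝ} (h : π < r) : sphereCap x r = univ :=
  eq_univ_of_forall fun _ => lt_of_le_of_lt (angle_le_pi _ _) h

/-- **Cap inclusion by the spherical triangle inequality**: if `angle x w + ρ ≤ r₁` and `angle z w + ρ ≤ r₂`
then `cap(w, ρ) ⊆ cap(x, r₁) ∩ cap(z, r₂)`. -/
theorem sphereCap_subset_inter {x z w : sphere (0 : EuclideanSpace ℝ m) 1} {ρ r₁ r₂ : ℝ}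
    (h₁ : angle (x : EuclideanSpace ℝ m) (w : EuclideanSpace ℝ m) + ρ ≤ r₁)
    (h₂ : angle (z : EuclideanSpace ℝ m) (w : EuclideanSpace ℝ m) + ρ ≤ r₂) :
    sphereCap w ρ ⊆ sphereCap x r₁ ∩ sphereCap z r₂ := by
  intro y hy
  rw [mem_sphereCap] at hy
  exact ⟨lt_of_le_of_lt (angle_le_angle_add_angle _ (w : EuclideanSpace ℝ m) _) (by linarith),
    lt_of_le_of_lt (angle_le_angle_add_angle _ (w : EuclideanSpace ℝ m) _) (by linarith)⟩

/-! ## §2 The halfway point -/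

section Halfway

variable {V : Type*} [NormedAddCommGroup V] [InnerProductSpace ℝ V]

/-- **Half-angle at the halfway point**: for unit vectors `x, z` with `x + z ≠ 0`,
`angle x (x + z) = angle x z / 2`. -/
theorem angle_self_add {x z : V} (hx : ‖x‖ = 1) (hz : ‖z‖ = 1) (hs : x + z ≠ 0) :
    angle x (x + z) = angle x z / 2 := by
  set θ := angle x z with hθ
  have hθ0 : 0 ≤ θ := angle_nonneg x z
  have hθπ : θ ≤ π := angle_le_pi x z
  have hcos : ⟪x, z⟫_ℝ = Real.cos θ := by
    rw [hθ, cos_angle, hx, hz, mul_one, div_one]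
  -- `‖x + z‖² = 2 (1 + cos θ)` and `⟪x, x + z⟫ = 1 + cos θ`
  have hns : ‖x + z‖ ^ 2 = 2 * (1 + Real.cos θ) := by
    rw [norm_add_sq_real, hx, hz, hcos]; ring
  have hin : ⟪x, x + z⟫_ℝ = 1 + Real.cos θ := by
    rw [inner_add_right, real_inner_self_eq_norm_sq, hx, hcos]; ring
  have hpos : 0 < ‖x + z‖ := norm_pos_iff.2 hs
  have h1c : 0 < 1 + Real.cos θ := by
    have := hns ▸ pow_pos hpos 2
    linarith
  -- `cos (angle x (x+z)) = (1 + cos θ)/‖x+z‖ = √((1 + cos θ)/2) = cos (θ/2)`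
  have hc2 : Real.cos (θ / 2) = Real.sqrt ((1 + Real.cos θ) / 2) :=
    Real.cos_half (by linarith [Real.pi_pos]) hθπ
  have hcosA : Real.cos (angle x (x + z)) = Real.cos (θ / 2) := by
    rw [cos_angle, hx, one_mul, hin, hc2]
    have hnorm : ‖x + z‖ = Real.sqrt (2 * (1 + Real.cos θ)) := by
      rw [← hns, Real.sqrt_sq hpos.le]
    rw [hnorm, div_eq_iff (Real.sqrt_pos.2 (by positivity)).ne', ← Real.sqrt_mul (by positivity)]
    rw [show (1 + Real.cos θ) / 2 * (2 * (1 + Real.cos θ)) = (1 + Real.cos θ) ^ 2 by ring, Real.sqrt_sq h1c.le]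
  exact Real.injOn_cos ⟨angle_nonneg _ _, angle_le_pi _ _⟩ ⟨by linarith, by linarith⟩ hcosA

/-- The symmetric statement: `angle z (x + z) = angle x z / 2`. -/
theorem angle_add_self' {x z : V} (hx : ‖x‖ = 1) (hz : ‖z‖ = 1) (hs : x + z ≠ 0) :
    angle z (x + z) = angle x z / 2 := by
  rw [add_comm, angle_comm x z]
  exact angle_self_add hz hx (by rwa [add_comm])

/-- In dimension `≥ 2` every unit vector has a unit vector orthogonal to it. -/
theorem exists_unit_orthogonal (h2 : 2 ≤ Fintype.card m) (x : EuclideanSpace ℝ m) (hx : x ≠ 0) :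
    ∃ u : EuclideanSpace ℝ m, ‖u‖ = 1 ∧ ⟪x, u⟫_ℝ = 0 := by
  set K : Submodule ℝ (EuclideanSpace ℝ m) := (ℝ ∙ x)ᗮ with hK
  have hfin : Module.finrank ℝ K = Fintype.card m - 1 := by
    have h := Submodule.finrank_add_finrank_orthogonal (ℝ ∙ x)
    rw [finrank_span_singleton hx, finrank_euclideanSpace] at h
    rw [hK]
    omega
  have hpos : 0 < Module.finrank ℝ K := by rw [hfin]; omega
  obtain ⟨v, hv⟩ := Module.finrank_pos_iff_exists_ne_zero.1 hpos
  have hvE : (v : EuclideanSpace ℝ m) ≠ 0 := fun h => hv (Subtype.ext h)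
  have hvn : ‖(v : EuclideanSpace ℝ m)‖ ≠ 0 := norm_ne_zero_iff.2 hvE
  refine ⟨‖(v : EuclideanSpace ℝ m)‖⁻¹ • (v : EuclideanSpace ℝ m), ?_, ?_⟩
  · rw [norm_smul, norm_inv, norm_norm, inv_mul_cancel₀ hvn]
  · rw [real_inner_smul_right]
    have hx' : ⟪x, (v : EuclideanSpace ℝ m)⟫_ℝ = 0 := by
      have hmem : (v : EuclideanSpace ℝ m) ∈ (ℝ ∙ x)ᗮ := hK ▸ v.2
      exact (Submodule.mem_orthogonal_singleton_iff_inner_right.1 hmem)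
    rw [hx', mul_zero]

/-- **The halfway point** (`dim ≥ 2`): for all `x, z ∈ S` there is `w ∈ S` with
`angle x w ≤ angle x z / 2` and `angle z w ≤ angle x z / 2` — the normalised sum, or, for antipodes
(`x + z = 0`, angle `π`), any unit vector orthogonal to `x`. -/
theorem exists_halfway (h2 : 2 ≤ Fintype.card m) (x z : sphere (0 : EuclideanSpace ℝ m) 1) :
    ∃ w : sphere (0 : EuclideanSpace ℝ m) 1,
      angle (x : EuclideanSpace ℝ m) (w : EuclideanSpace ℝ m) ≤ angle (x : EuclideanSpace ℝ m) (z : EuclideanSpace ℝ m) / 2 ∧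
      angle (z : EuclideanSpace ℝ m) (w : EuclideanSpace ℝ m) ≤ angle (x : EuclideanSpace ℝ m) (z : EuclideanSpace ℝ m) / 2 := by
  have hx : ‖(x : EuclideanSpace ℝ m)‖ = 1 := norm_eq_of_mem_sphere x
  have hz : ‖(z : EuclideanSpace ℝ m)‖ = 1 := norm_eq_of_mem_sphere z
  by_cases hs : (x : EuclideanSpace ℝ m) + (z : EuclideanSpace ℝ m) = 0
  · -- antipodes: the angle is `π`, any unit normal of `x` is halfway
    have hzx : (z : EuclideanSpace ℝ m) = -(x : EuclideanSpace ℝ m) := eq_neg_of_add_eq_zero_right hs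
    obtain ⟨u, hu, hxu⟩ := exists_unit_orthogonal h2 (x : EuclideanSpace ℝ m) (ne_zero_of_mem_unit_sphere x)
    have hπ : angle (x : EuclideanSpace ℝ m) (z : EuclideanSpace ℝ m) = π := by
      rw [hzx, angle_neg_right, angle_self (ne_zero_of_mem_unit_sphere x), sub_zero]
    have hxu' : angle (x : EuclideanSpace ℝ m) u = π / 2 := by
      rw [InnerProductGeometry.inner_eq_zero_iff_angle_eq_pi_div_two] at hxu; exact hxu
    refine ⟨⟨u, mem_sphere_zero_iff_norm.2 hu⟩, ?_, ?_⟩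
    · rw [hπ, hxu']
    · rw [hπ, hzx, angle_neg_left, hxu']; linarith
  · set s := (x : EuclideanSpace ℝ m) + (z : EuclideanSpace ℝ m) with hs_def
    have hsn : ‖s‖ ≠ 0 := norm_ne_zero_iff.2 hs
    have hw : ‖‖s‖⁻¹ • s‖ = 1 := by rw [norm_smul, norm_inv, norm_norm, inv_mul_cancel₀ hsn]
    refine ⟨⟨‖s‖⁻¹ • s, mem_sphere_zero_iff_norm.2 hw⟩, ?_, ?_⟩
    · show angle (x : EuclideanSpace ℝ m) (‖s‖⁻¹ • s) ≤ _
      rw [angle_smul_right_of_pos _ _ (inv_pos.2 (norm_pos_iff.2 hs)), hs_def, angle_self_add hx hz hs]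
    · show angle (z : EuclideanSpace ℝ m) (‖s‖⁻¹ • s) ≤ _
      rw [angle_smul_right_of_pos _ _ (inv_pos.2 (norm_pos_iff.2 hs)), hs_def, angle_add_self' hx hz hs]

end Halfway

/-! ## §3 The uniform law of a cap -/

section Measure

variable [DecidableEq m] [Nonempty m]

omit [Nonempty m] in
/-- Rotations map caps to caps: the preimage of `cap(O x, r)` under `actSO O` is `cap(x, r)`. -/
theorem preimage_actSO_sphereCap (O : Matrix.specialOrthogonalGroup m ℝ) (x : sphere (0 : EuclideanSpace ℝ m) 1) (r : ℝ) :
    actSO O ⁻¹' sphereCap (actSO O x) r = sphereCap x r := by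
  ext y
  simp only [mem_preimage, mem_sphereCap, coe_actSO_eq_rotSO]
  rw [show (rotSO O) (x : EuclideanSpace ℝ m) = (rotSO O).toLinearIsometry x from rfl,
    show (rotSO O) (y : EuclideanSpace ℝ m) = (rotSO O).toLinearIsometry y from rfl, LinearIsometry.angle_map]

/-- **The uniform law of a cap does not depend on its centre** (`dim ≥ 2`). -/
theorem uniformSphere_sphereCap_eq (h2 : 2 ≤ Fintype.card m) (x y : sphere (0 : EuclideanSpace ℝ m) 1) (r : ℝ) :
    uniformSphere (volume : Measure (EuclideanSpace ℝ m)) (sphereCap x r) =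
      uniformSphere (volume : Measure (EuclideanSpace ℝ m)) (sphereCap y r) := by
  obtain ⟨O, rfl⟩ := exists_actSO_eq h2 x y
  have hinv := uniformSphere_map_linearIsometryEquiv (rotSO O) (actSO O) (coe_actSO_eq_rotSO O)
  have hmeas : Measurable (actSO O : sphere (0 : EuclideanSpace ℝ m) 1 → sphere (0 : EuclideanSpace ℝ m) 1) :=
    measurable_actSO_right O
  conv_rhs => rw [← hinv, Measure.map_apply hmeas (measurableSet_sphereCap _ _), preimage_actSO_sphereCap]

/-- **Caps have positive uniform measure** (`dim ≥ 2`, `r > 0`): finitely many caps of radius `r` cover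
the compact sphere, all of the same measure, and the total mass is one. -/
theorem uniformSphere_sphereCap_pos (h2 : 2 ≤ Fintype.card m) (x : sphere (0 : EuclideanSpace ℝ m) 1) {r : ℝ} (hr : 0 < r) :
    0 < uniformSphere (volume : Measure (EuclideanSpace ℝ m)) (sphereCap x r) := by
  -- a finite subcover by open caps
  obtain ⟨t, ht⟩ := isCompact_univ.elim_finite_subcover (fun y : sphere (0 : EuclideanSpace ℝ m) 1 => sphereCap y r)
    (fun y => isOpen_sphereCap y r) (fun y _ => mem_iUnion.2 ⟨y, mem_sphereCap_self y hr⟩)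
  by_contra h
  have h0 : uniformSphere (volume : Measure (EuclideanSpace ℝ m)) (sphereCap x r) = 0 := le_antisymm (not_lt.1 h) bot_le
  have hall : ∀ y, uniformSphere (volume : Measure (EuclideanSpace ℝ m)) (sphereCap y r) = 0 := fun y => by
    rw [uniformSphere_sphereCap_eq h2 y x, h0]
  have huniv : uniformSphere (volume : Measure (EuclideanSpace ℝ m)) univ ≤
      ∑ y ∈ t, uniformSphere (volume : Measure (EuclideanSpace ℝ m)) (sphereCap y r) :=
    (measure_mono ht).trans (measure_biUnion_finset_le t _)
  have h1 : uniformSphere (volume : Measure (EuclideanSpace ℝ m)) univ = 1 := measure_univ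
  rw [h1] at huniv
  simp only [hall, Finset.sum_const_zero, nonpos_iff_eq_zero, one_ne_zero] at huniv

end Measure

end Summit.Ventures.LatticeQCDFlow.Exactness
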